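import Summits.Ventures.LatticeQCDFlow.Exactness.IMHTotalVariationContraction
import Summits.Ventures.LatticeQCDFlow.Exactness.IMHAnyStartPathSplit
import HarnessLib

/-!
# Total-variation contraction ON PATH SPACE: after `b` discarded updates, every event and every bounded statistic of the whole
# future differs between two starts by at most `(1 − A)^b·δ` (times its range), `δ` the initial set-wise distance

HONEST FRAMING: exact (Metropolis-corrected) sampling algorithms for lattice gauge theory;
figures of merit are autocorrelation/cost numbers at stated couplings and volumes; no
continuum-physics claim.

Venture `LatticeQCDFlow` (cell pub-lqcd), topic `Exactness`; FANOUT row 30 (lean-1, GEN-37).  NEW WORK of the cell,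
general state space; sequel to `Exactness/IMHTotalVariationContraction` (this generation: `|μ₀Kⁿ(B) − ν₀Kⁿ(B)| ≤ rⁿδ` set by set)
lifted to Mathlib's path law `Kernel.trajMeasure` (`P_μ` = the initial law composed with ONE kernel into path space) with the
Scoring row's shift bookkeeping (`IMHColdStartPathMixture.chain_map_shift_eq`: `P_{μ₀}∘θ_b⁻¹ = P_{μ₀K^b}`).  Def-free as before
(`|μ₀(C) − ν₀(C)| ≤ δ` on measurable sets is the hypothesis):

* §1 (any Markov kernel) **`map_real_sub_abs_le_of_setwise`** — push-forwards keep set-wise closeness; **`bind_real_sub_abs_le'`** —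
  so do Markov kernels between different spaces; **`chain_real_sub_abs_le_of_setwise`** — THE PATH LAWS OF ONE KERNEL FROM TWO
  CLOSE STARTS ARE CLOSE: `|P_μ(E) − P_ν(E)| ≤ δ` for every measurable set of paths `E`; **`chain_integral_sub_abs_le_of_setwise`** —
  `|E_μ F − E_ν F| ≤ δ·(c − a)` for measurable path statistics `a ≤ F ≤ c`.
* §2 flow-MCMC (`K = indepMH q w`, `w` maximal at `x₀`, `r = 1 − 1/w(x₀)`): **`imh_chain_shift_tv_contraction`** — for two initial laws
  at set-wise distance `≤ δ`, every `b` and every measurable set of paths `E`: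
  `|P_{μ₀}(X_{b+·} ∈ E) − P_{ν₀}(X_{b+·} ∈ E)| ≤ r^b·δ`; **`imh_chain_shift_integral_tv_contraction`** — every bounded measurable
  statistic of the future after `b` discards (window averages, autocovariance estimators, running maxima, hitting indicators…)
  differs by at most `r^b·δ·(c − a)` in expectation; **`imh_chain_shift_integral_tv_to_stationary`** — against the EQUILIBRIUM RUN:
  `|E_{μ₀}F(X_{b+·}) − E_π F| ≤ r^b·δ·(c − a)` whenever `|μ₀(C) − π(C)| ≤ δ` (GEN-34's any-start bound is `δ = 1`; a warm start
  at distance `δ` saves `log(1/δ)/A` discarded updates for the same guarantee on EVERY statistic of the run).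
NOT CLAIMED: a total-variation functional on path space (def-free); attainment; anything for two different kernels.
No `sorry`, no new definitions, nothing cited as a fact.
-/

noncomputable section

namespace Summit.Ventures.LatticeQCDFlow.Exactness

open MeasureTheory ProbabilityTheory Function
open scoped ENNReal
open Summit.Ventures.LatticeQCDFlow.Scoring

variable {Ω : Type*} [MeasurableSpace Ω] {q : Measure Ω} [IsProbabilityMeasure q] {w : Ω → ℝ}

/-! ## §1 Set-wise closeness survives push-forwards, kernels into other spaces, and the passage to path laws -/

omit [IsProbabilityMeasure q] in
/-- **Push-forwards keep set-wise closeness**: `|μ(f⁻¹C) − ν(f⁻¹C)| ≤ δ`. [ours, bookkeeping] -/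
theorem map_real_sub_abs_le_of_setwise {β : Type*} [MeasurableSpace β] (μ ν : Measure Ω) {δ : ℝ}
    (hδ : ∀ C, MeasurableSet C → |μ.real C - ν.real C| ≤ δ) {f : Ω → β} (hf : Measurable f) {C : Set β}
    (hC : MeasurableSet C) : |(μ.map f).real C - (ν.map f).real C| ≤ δ := by
  simp only [measureReal_def]
  rw [Measure.map_apply hf hC, Measure.map_apply hf hC]
  exact hδ _ (hf hC)

omit [IsProbabilityMeasure q] in
/-- **A Markov kernel into any space keeps set-wise closeness** (`μQ(B) = ∫ Q(x, B) dμ`, `0 ≤ Q(·, B) ≤ 1`, row 9's observable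
transfer). [ours] -/
theorem bind_real_sub_abs_le' {β : Type*} [MeasurableSpace β] (Q : Kernel Ω β) [IsMarkovKernel Q] (μ ν : Measure Ω)
    [IsProbabilityMeasure μ] [IsProbabilityMeasure ν] {δ : ℝ} (hδ : ∀ C, MeasurableSet C → |μ.real C - ν.real C| ≤ δ)
    {B : Set β} (hB : MeasurableSet B) : |(μ.bind Q).real B - (ν.bind Q).real B| ≤ δ := by
  have hrepr : ∀ (m : Measure Ω), (m.bind Q).real B = ∫ x, (Q x).real B ∂m := by
    intro m
    simp only [measureReal_def]
    rw [Measure.bind_apply hB (Kernel.aemeasurable _),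
      integral_toReal ((Kernel.measurable_coe Q hB).aemeasurable) (ae_of_all _ fun x => measure_lt_top _ _)]
  rw [hrepr μ, hrepr ν]
  exact abs_integral_sub_integral_le_of_setwise hδ ((Kernel.measurable_coe Q hB).ennreal_toReal)
    (fun x => ENNReal.toReal_nonneg) (fun x => by
      simpa only [measureReal_def] using (measureReal_le_one (μ := Q x) (s := B)))

omit [IsProbabilityMeasure q] in
/-- **THE PATH LAWS OF ONE KERNEL FROM TWO CLOSE STARTS ARE CLOSE**: `|μ(C) − ν(C)| ≤ δ` on measurable sets ⇒
`|P_μ(E) − P_ν(E)| ≤ δ` for every measurable set of paths `E` (Mathlib's `trajMeasure` = the initial law, transported to time-`0`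
histories, composed with one kernel into path space). [ours] -/
theorem chain_real_sub_abs_le_of_setwise (κ : Kernel Ω Ω) [IsMarkovKernel κ] (μ ν : Measure Ω) [IsProbabilityMeasure μ]
    [IsProbabilityMeasure ν] {δ : ℝ} (hδ : ∀ C, MeasurableSet C → |μ.real C - ν.real C| ≤ δ) {E : Set (ℕ → Ω)}
    (hE : MeasurableSet E) :
    |(Kernel.trajMeasure (X := fun _ : ℕ => Ω) μ
        (fun n : ℕ => κ.comap (fun h : (i : ↥(Finset.Iic n)) → Ω => h ⟨n, Finset.mem_Iic.2 le_rfl⟩)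
          (measurable_pi_apply _))).real E -
      (Kernel.trajMeasure (X := fun _ : ℕ => Ω) ν
        (fun n : ℕ => κ.comap (fun h : (i : ↥(Finset.Iic n)) → Ω => h ⟨n, Finset.mem_Iic.2 le_rfl⟩)
          (measurable_pi_apply _))).real E| ≤ δ := by
  unfold Kernel.trajMeasure
  haveI : IsProbabilityMeasure (μ.map (MeasurableEquiv.piUnique (fun _ : ↥(Finset.Iic 0) => Ω)).symm) :=
    Measure.isProbabilityMeasure_map (MeasurableEquiv.measurable _).aemeasurable
  haveI : IsProbabilityMeasure (ν.map (MeasurableEquiv.piUnique (fun _ : ↥(Finset.Iic 0) => Ω)).symm) :=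
    Measure.isProbabilityMeasure_map (MeasurableEquiv.measurable _).aemeasurable
  exact bind_real_sub_abs_le' _ _ _ (fun C hC => map_real_sub_abs_le_of_setwise μ ν hδ (MeasurableEquiv.measurable _) hC) hE

omit [IsProbabilityMeasure q] in
/-- **… AND SO ARE THEIR BOUNDED STATISTICS**: `|E_μ F − E_ν F| ≤ δ·(c − a)` for measurable path statistics `a ≤ F ≤ c`. [ours] -/
theorem chain_integral_sub_abs_le_of_setwise (κ : Kernel Ω Ω) [IsMarkovKernel κ] (μ ν : Measure Ω) [IsProbabilityMeasure μ]
    [IsProbabilityMeasure ν] {δ : ℝ} (hδ : ∀ C, MeasurableSet C → |μ.real C - ν.real C| ≤ δ) {F : (ℕ → Ω) → ℝ}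
    (hF : Measurable F) {a c : ℝ} (ha : ∀ x, a ≤ F x) (hc : ∀ x, F x ≤ c) :
    |∫ x, F x ∂(Kernel.trajMeasure (X := fun _ : ℕ => Ω) μ
        (fun n : ℕ => κ.comap (fun h : (i : ↥(Finset.Iic n)) → Ω => h ⟨n, Finset.mem_Iic.2 le_rfl⟩)
          (measurable_pi_apply _))) -
      ∫ x, F x ∂(Kernel.trajMeasure (X := fun _ : ℕ => Ω) ν
        (fun n : ℕ => κ.comap (fun h : (i : ↥(Finset.Iic n)) → Ω => h ⟨n, Finset.mem_Iic.2 le_rfl⟩)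
          (measurable_pi_apply _)))| ≤ δ * (c - a) := by
  have h := abs_integral_sub_integral_le_mul_of_setwise _ _
    (fun E hE => chain_real_sub_abs_le_of_setwise κ μ ν hδ hE) hF ha hc
  linarith

/-! ## §2 Flow-MCMC: the future after `b` discards contracts at rate `r^b` times the initial distance -/

/-- **TOTAL-VARIATION CONTRACTION ON PATH SPACE.**  `w` measurable (a `Fact`), positive, normalised, maximal at `x₀`
(`r = 1 − 1/w(x₀)`).  For two initial laws with `|μ₀(C) − ν₀(C)| ≤ δ` on measurable sets, every `b` and every measurable set of
paths `E`: `|P_{μ₀}(X_{b+·} ∈ E) − P_{ν₀}(X_{b+·} ∈ E)| ≤ r^b·δ`. [ours] -/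
theorem imh_chain_shift_tv_contraction [Fact (Measurable w)] (hw0 : ∀ y, 0 < w y) {x₀ : Ω} (hmax : ∀ y, w y ≤ w x₀)
    [IsProbabilityMeasure (q.withDensity fun y => ENNReal.ofReal (w y))]
    (μ₀ ν₀ : Measure Ω) [IsProbabilityMeasure μ₀] [IsProbabilityMeasure ν₀] {δ : ℝ}
    (hδ : ∀ C, MeasurableSet C → |μ₀.real C - ν₀.real C| ≤ δ) (b : ℕ) {E : Set (ℕ → Ω)} (hE : MeasurableSet E) :
    |((Kernel.trajMeasure (X := fun _ : ℕ => Ω) μ₀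
        (fun n : ℕ => (indepMH q w).comap (fun h : (i : ↥(Finset.Iic n)) → Ω => h ⟨n, Finset.mem_Iic.2 le_rfl⟩)
          (measurable_pi_apply _))).map (fun (x : ℕ → Ω) (n : ℕ) => x (b + n))).real E -
      ((Kernel.trajMeasure (X := fun _ : ℕ => Ω) ν₀
        (fun n : ℕ => (indepMH q w).comap (fun h : (i : ↥(Finset.Iic n)) → Ω => h ⟨n, Finset.mem_Iic.2 le_rfl⟩)
          (measurable_pi_apply _))).map (fun (x : ℕ → Ω) (n : ℕ) => x (b + n))).real E| ≤ (1 - (w x₀)⁻¹) ^ b * δ := by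
  haveI := isProbabilityMeasure_iterate_bind (κ := indepMH q w) μ₀ b
  haveI := isProbabilityMeasure_iterate_bind (κ := indepMH q w) ν₀ b
  rw [chain_map_shift_eq (indepMH q w) μ₀ b, chain_map_shift_eq (indepMH q w) ν₀ b]
  exact chain_real_sub_abs_le_of_setwise (indepMH q w) _ _
    (fun C hC => iterate_bind_indepMH_tv_contraction hw0 hmax b μ₀ ν₀ hδ hC) hE

/-- **EVERY BOUNDED STATISTIC OF THE FUTURE AFTER `b` DISCARDS**: for measurable `a ≤ F ≤ c` on paths,
`|E_{μ₀} F(X_{b+·}) − E_{ν₀} F(X_{b+·})| ≤ r^b·δ·(c − a)`. [ours] -/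
theorem imh_chain_shift_integral_tv_contraction [Fact (Measurable w)] (hw0 : ∀ y, 0 < w y) {x₀ : Ω}
    (hmax : ∀ y, w y ≤ w x₀) [IsProbabilityMeasure (q.withDensity fun y => ENNReal.ofReal (w y))]
    (μ₀ ν₀ : Measure Ω) [IsProbabilityMeasure μ₀] [IsProbabilityMeasure ν₀] {δ : ℝ}
    (hδ : ∀ C, MeasurableSet C → |μ₀.real C - ν₀.real C| ≤ δ) (b : ℕ) {F : (ℕ → Ω) → ℝ} (hF : Measurable F)
    {a c : ℝ} (ha : ∀ x, a ≤ F x) (hc : ∀ x, F x ≤ c) :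
    |∫ x, F (fun n => x (b + n)) ∂(Kernel.trajMeasure (X := fun _ : ℕ => Ω) μ₀
        (fun n : ℕ => (indepMH q w).comap (fun h : (i : ↥(Finset.Iic n)) → Ω => h ⟨n, Finset.mem_Iic.2 le_rfl⟩)
          (measurable_pi_apply _))) -
      ∫ x, F (fun n => x (b + n)) ∂(Kernel.trajMeasure (X := fun _ : ℕ => Ω) ν₀
        (fun n : ℕ => (indepMH q w).comap (fun h : (i : ↥(Finset.Iic n)) → Ω => h ⟨n, Finset.mem_Iic.2 le_rfl⟩)
          (measurable_pi_apply _)))| ≤ (1 - (w x₀)⁻¹) ^ b * δ * (c - a) := by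
  haveI := isProbabilityMeasure_iterate_bind (κ := indepMH q w) μ₀ b
  haveI := isProbabilityMeasure_iterate_bind (κ := indepMH q w) ν₀ b
  have hΘ : Measurable (fun (x : ℕ → Ω) (n : ℕ) => x (b + n)) := measurable_pi_lambda _ fun n => measurable_pi_apply _
  rw [← integral_map hΘ.aemeasurable hF.aestronglyMeasurable, ← integral_map hΘ.aemeasurable hF.aestronglyMeasurable,
    chain_map_shift_eq (indepMH q w) μ₀ b, chain_map_shift_eq (indepMH q w) ν₀ b]
  exact chain_integral_sub_abs_le_of_setwise (indepMH q w) _ _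
    (fun C hC => iterate_bind_indepMH_tv_contraction hw0 hmax b μ₀ ν₀ hδ hC) hF ha hc

/-- **AGAINST THE EQUILIBRIUM RUN**: if `|μ₀(C) − π(C)| ≤ δ` on measurable sets then for every `b` and every measurable path
statistic `a ≤ F ≤ c`: `|E_{μ₀} F(X_{b+·}) − E_π F| ≤ r^b·δ·(c − a)` (the equilibrium run is shift invariant). [ours] -/
theorem imh_chain_shift_integral_tv_to_stationary [Fact (Measurable w)] (hw0 : ∀ y, 0 < w y) {x₀ : Ω}
    (hmax : ∀ y, w y ≤ w x₀) [IsProbabilityMeasure (q.withDensity fun y => ENNReal.ofReal (w y))]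
    (μ₀ : Measure Ω) [IsProbabilityMeasure μ₀] {δ : ℝ}
    (hδ : ∀ C, MeasurableSet C → |μ₀.real C - (q.withDensity fun y => ENNReal.ofReal (w y)).real C| ≤ δ) (b : ℕ)
    {F : (ℕ → Ω) → ℝ} (hF : Measurable F) {a c : ℝ} (ha : ∀ x, a ≤ F x) (hc : ∀ x, F x ≤ c) :
    |∫ x, F (fun n => x (b + n)) ∂(Kernel.trajMeasure (X := fun _ : ℕ => Ω) μ₀
        (fun n : ℕ => (indepMH q w).comap (fun h : (i : ↥(Finset.Iic n)) → Ω => h ⟨n, Finset.mem_Iic.2 le_rfl⟩)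
          (measurable_pi_apply _))) -
      ∫ x, F x ∂(Kernel.trajMeasure (X := fun _ : ℕ => Ω) (q.withDensity fun y => ENNReal.ofReal (w y))
        (fun n : ℕ => (indepMH q w).comap (fun h : (i : ↥(Finset.Iic n)) → Ω => h ⟨n, Finset.mem_Iic.2 le_rfl⟩)
          (measurable_pi_apply _)))| ≤ (1 - (w x₀)⁻¹) ^ b * δ * (c - a) := by
  set π : Measure Ω := q.withDensity fun y => ENNReal.ofReal (w y) with hπ
  have h := imh_chain_shift_integral_tv_contraction (q := q) hw0 hmax μ₀ π hδ b hF ha hc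
  -- the equilibrium run is shift invariant: `E_π F(X_{b+·}) = E_π F`
  have hΘ : Measurable (fun (x : ℕ → Ω) (n : ℕ) => x (b + n)) := measurable_pi_lambda _ fun n => measurable_pi_apply _
  have hinv : (π.bind (indepMH q w)) = π := (indepMH_invariant (q := q) Fact.out hw0).def
  have hfix : ∀ n : ℕ, (fun m : Measure Ω => m.bind (indepMH q w))^[n] π = π := by
    intro n
    induction n with
    | zero => rfl
    | succ n ih => rw [Function.iterate_succ_apply, hinv, ih]
  have hstat : ∫ x, F (fun n => x (b + n)) ∂(Kernel.trajMeasure (X := fun _ : ℕ => Ω) π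
        (fun n : ℕ => (indepMH q w).comap (fun h : (i : ↥(Finset.Iic n)) → Ω => h ⟨n, Finset.mem_Iic.2 le_rfl⟩)
          (measurable_pi_apply _))) =
      ∫ x, F x ∂(Kernel.trajMeasure (X := fun _ : ℕ => Ω) π
        (fun n : ℕ => (indepMH q w).comap (fun h : (i : ↥(Finset.Iic n)) → Ω => h ⟨n, Finset.mem_Iic.2 le_rfl⟩)
          (measurable_pi_apply _))) := by
    rw [← integral_map hΘ.aemeasurable hF.aestronglyMeasurable, chain_map_shift_eq (indepMH q w) π b, hfix b]
  rwa [hstat] at h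

end Summit.Ventures.LatticeQCDFlow.Exactness

end
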